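import Mathlib
import Summits.ValiantsHypothesis.ValiantsHypothesis.Theorems.RigidityForcesSymmetryRankRigidMinimalReprLaplaceFiveSectorSplitDefs
import Summits.ValiantsHypothesis.ValiantsHypothesis.Theorems.RigidityForcesSymmetryRankRigidMinimalReprLaplaceFiveTriangleNoSideSym
import Summits.ValiantsHypothesis.ValiantsHypothesis.Theorems.RigidityForcesSymmetryRankRigidMinimalReprLaplaceFiveThreeSplitCrossSwap
import Summits.ValiantsHypothesis.ValiantsHypothesis.Theorems.RigidityForcesSymmetryRankRigidMinimalReprLaplaceFiveSlackCoherence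
import Summits.ValiantsHypothesis.ValiantsHypothesis.Theorems.RigidityForcesSymmetryRankRigidMinimalReprLaplaceFiveStarSymmetricShadow
import Summits.ValiantsHypothesis.ValiantsHypothesis.Theorems.RigidityForcesSymmetryRankRigidMinimalReprLaplaceFiveStarRankOne

/-!
# ValiantsHypothesis / RigidityForcesSymmetry — crux `LaplaceOptimalFive` (stmt-ValiantsHypothesis-24813), crux idea
`young-shadow` (K1) ON THE STAR: **A SPLIT CARRYING ONE TERM FORCES WEIGHT ≥ 120**

Word-currency corollary of LEMMA 1 (✓ `LaplaceFiveStar.rankOne_closed`).  In a side-symmetric pair decomposition of `P₅`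
supported on the star `{pa, pb, pc, pd}`, ✓ `star_coherence` (conjunct 4) says that the shadow `Z_{pa}` symmetrised over the star,
`Z + (a b)•Z + (a c)•Z + (a d)•Z`, is fully slot-symmetric.  If the split `{p,a}` carries exactly ONE term, `Z = u ⊗ w` is a
single side-symmetric product; reading `u` and `w` as letter functions `U`, `W`, invariance of the symmetrisation under `(p a)` is
the exchange identity `(C)` of LEMMA 1, whose conclusion `U a b·W c d e = U a c·W b d e` says that `Z` is invariant under the CROSS
transposition `(a b)`; ✓ `full_of_crossSwap` makes `Z` fully symmetric and ✓ `sideSym_star_of_symmetric_shadow` (one symmetric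
shadow on a star ⟹ all ⟹ needTen) gives `5! ≤ laplaceWeight`.

So K1 on the star can only fail when EVERY one of the four splits carries at least two terms — with ✓ `sideSym_threePairSplits`
(≤ 3 splits) the residual profiles of a weight-`< 120` star decomposition are `(2,2,2,2)` and `(2,2,2,3)` (memo
`pub/val-lit/lmr/NOTE-p4g15-24813-K1-star.md` §3, star note r3 §8/§9 of val-idea-19 g7; their exclusion is LEMMA 2′, not here).

Honest framing.  K1 on the star in general (`sideSym_starPairSplits`), K1 on `C₄` / `K₃ ⊔ K₂` / `≥ 5` splits, S2′,
`LaplaceOptimalFive` (OPEN · CONTESTED 72/120), `RankRigidMinimalRepr`, `VP ≠ VNP` are NOT proved.  No definitions, no `sorry`.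
-/

set_option linter.dupNamespace false

namespace Summit.ValiantsHypothesis.ValiantsHypothesis.Theorems.RigidityForcesSymmetryRankRigidMinimalRepr

namespace LaplaceFiveStar

open Finset LaplaceFiveSectorSplit

/-- **Lone term, word currency.**  `u` reads the slots `p, a` symmetrically, `w` reads the slots `b, c, d` symmetrically
(`p,a,b,c,d` distinct), and `Z = u·w` symmetrised over the star is invariant under the slot transposition `(p a)`.  Then `Z` is
invariant under the cross transposition `(a b)`. [folklore] -/
theorem lone_term_crossSwap (p a b c d : Fin 5) (hpa : p ≠ a) (hpb : p ≠ b) (hpc : p ≠ c) (hpd : p ≠ d) (hab : a ≠ b)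
    (hac : a ≠ c) (had : a ≠ d) (hbc : b ≠ c) (hbd : b ≠ d) (hcd : c ≠ d) (u w : (Fin 5 → Fin 5) → ℂ)
    (hu : ∀ v v' : Fin 5 → Fin 5, v p = v' p → v a = v' a → u v = u v')
    (hw : ∀ v v' : Fin 5 → Fin 5, v b = v' b → v c = v' c → v d = v' d → w v = w v')
    (hus : ∀ v : Fin 5 → Fin 5, u (v ∘ ⇑(Equiv.swap p a)) = u v)
    (hwbc : ∀ v : Fin 5 → Fin 5, w (v ∘ ⇑(Equiv.swap b c)) = w v)
    (hwcd : ∀ v : Fin 5 → Fin 5, w (v ∘ ⇑(Equiv.swap c d)) = w v)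
    (hF : ∀ v : Fin 5 → Fin 5,
      u ((v ∘ ⇑(Equiv.swap p a))) * w ((v ∘ ⇑(Equiv.swap p a)))
        + u ((v ∘ ⇑(Equiv.swap p a)) ∘ ⇑(Equiv.swap a b)) * w ((v ∘ ⇑(Equiv.swap p a)) ∘ ⇑(Equiv.swap a b))
        + u ((v ∘ ⇑(Equiv.swap p a)) ∘ ⇑(Equiv.swap a c)) * w ((v ∘ ⇑(Equiv.swap p a)) ∘ ⇑(Equiv.swap a c))
        + u ((v ∘ ⇑(Equiv.swap p a)) ∘ ⇑(Equiv.swap a d)) * w ((v ∘ ⇑(Equiv.swap p a)) ∘ ⇑(Equiv.swap a d))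
      = u v * w v + u (v ∘ ⇑(Equiv.swap a b)) * w (v ∘ ⇑(Equiv.swap a b))
        + u (v ∘ ⇑(Equiv.swap a c)) * w (v ∘ ⇑(Equiv.swap a c)) + u (v ∘ ⇑(Equiv.swap a d)) * w (v ∘ ⇑(Equiv.swap a d))) :
    ∀ v : Fin 5 → Fin 5, u (v ∘ ⇑(Equiv.swap a b)) * w (v ∘ ⇑(Equiv.swap a b)) = u v * w v := by
  -- letter functions
  set U : Fin 5 → Fin 5 → ℂ := fun x y => u (fun i => if i = p then x else if i = a then y else x) with hUdef
  set W : Fin 5 → Fin 5 → Fin 5 → ℂ :=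
    fun x y z => w (fun i => if i = b then x else if i = c then y else if i = d then z else x) with hWdef
  have hap : a ≠ p := Ne.symm hpa
  have hcb : c ≠ b := Ne.symm hbc
  have hdb : d ≠ b := Ne.symm hbd
  have hdc : d ≠ c := Ne.symm hcd
  -- reading lemmas
  have F1 : ∀ v : Fin 5 → Fin 5, u v = U (v p) (v a) := fun v =>
    hu v _ (by simp) (by simp [hap])
  have F2 : ∀ v : Fin 5 → Fin 5, w v = W (v b) (v c) (v d) := fun v =>
    hw v _ (by simp) (by simp [hcb]) (by simp [hdb, hdc])
  -- symmetries of the letter functions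
  have hUsymm : ∀ x y, U x y = U y x := by
    intro x y
    have h1 : U y x = u ((fun i => if i = p then x else if i = a then y else x) ∘ ⇑(Equiv.swap p a)) := by
      refine hu _ _ ?_ ?_
      · simp [Function.comp_apply, hpa.symm]
      · simp [Function.comp_apply, hpa.symm]
    rw [h1, hus]
  have hW1 : ∀ x y z, W x y z = W y x z := by
    intro x y z
    have h1 : W y x z = w ((fun i => if i = b then x else if i = c then y else if i = d then z else x)
        ∘ ⇑(Equiv.swap b c)) := by
      refine hw _ _ ?_ ?_ ?_
      · simp [Function.comp_apply, hbc.symm]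
      · simp [Function.comp_apply, hbc.symm]
      · simp [Function.comp_apply, Equiv.swap_apply_def, hbd.symm, hcd.symm]
    rw [h1, hwbc]
  have hW2 : ∀ x y z, W x y z = W x z y := by
    intro x y z
    have h1 : W x z y = w ((fun i => if i = b then x else if i = c then y else if i = d then z else x)
        ∘ ⇑(Equiv.swap c d)) := by
      refine hw _ _ ?_ ?_ ?_
      · simp [Function.comp_apply, Equiv.swap_apply_def, hbc, hbd]
      · simp [Function.comp_apply, hbc.symm, hbd.symm, hcd.symm]
      · simp [Function.comp_apply, hbc.symm, hbd.symm, hcd.symm]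
    rw [h1, hwcd]
  -- the exchange identity (C) from `hF` at the word with letters `A, B, C, D, E` in the slots `p, a, b, c, d`
  have hC : ∀ A B C D E : Fin 5, U A C * W B D E + U A D * W B C E + U A E * W B C D
      = U B C * W A D E + U B D * W A C E + U B E * W A C D := by
    intro A B C D E
    set ω : Fin 5 → Fin 5 := fun i => if i = p then A else if i = a then B else if i = b then C else if i = c then D else E
      with hωdef
    have h := hF ω
    simp only [F1, F2, Function.comp_apply, Equiv.swap_apply_def] at h
    simp only [hωdef, hpa, hpb, hpc, hpd, hab, hac, had, hbc, hbd, hcd, hpa.symm, hpb.symm, hpc.symm, hpd.symm, hab.symm, hac.symm, had.symm, hbc.symm, hbd.symm, hcd.symm, if_true, if_false] at h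
    -- h : U B A * W C D E + U B C * W A D E + U B D * W C A E + U B E * W C D A
    --       = U A B * W C D E + U A C * W B D E + U A D * W C B E + U A E * W C D B   (up to the orderings produced)
    have e1 : W C B E = W B C E := hW1 C B E
    have e2 : W C D B = W B C D := by rw [hW2 C D B, hW1 C B D]
    have e3 : W C A E = W A C E := hW1 C A E
    have e4 : W C D A = W A C D := by rw [hW2 C D A, hW1 C A D]
    have e5 : U B A = U A B := hUsymm B A
    linear_combination (-1 : ℂ) * h + W C D E * e5 + U B D * e3 + U B E * e4 - U A D * e1 - U A E * e2
  -- LEMMA 1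
  have hG := rankOne_closed U W hUsymm hW1 hW2 hC
  intro v
  have e1 : u (v ∘ ⇑(Equiv.swap a b)) = U (v p) (v b) := by
    rw [F1]; simp [Function.comp_apply, Equiv.swap_apply_def, hpa, hpb]
  have e2 : w (v ∘ ⇑(Equiv.swap a b)) = W (v a) (v c) (v d) := by
    rw [F2]; simp [Function.comp_apply, Equiv.swap_apply_def, hac.symm, had.symm, hbc.symm, hbd.symm]
  rw [e1, e2, F1 v, F2 v]
  exact (hG (v p) (v a) (v b) (v c) (v d)).symm

/-- **K1 on the star: a split carrying exactly one term forces weight `≥ 120`.**  [folklore] -/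
theorem sideSym_starPairSplits_of_lone_term (N : ℕ) (T : Finset (Fin N)) (S : Fin N → Finset (Fin 5))
    (u w : Fin N → (Fin 5 → Fin 5) → ℂ) (hdec : IsSplitDecomposition T S u w) (hsym : SideSymmetric T S u w)
    (hpair : ∀ t ∈ T, (S t).card = 2) (h4 : (T.image S).card = 4) (hstar : ∃ c : Fin 5, ∀ A ∈ T.image S, c ∈ A)
    (hone : ∃ A ∈ T.image S, (T.filter (fun t => S t = A)).card = 1) :
    Nat.factorial 5 ≤ laplaceWeight T S := by
  classical
  obtain ⟨A₀, hA₀, hcard⟩ := hone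
  refine sideSym_star_of_symmetric_shadow N T S u w hdec hsym hpair hstar A₀ hA₀ ?_
  obtain ⟨hu, hw, hid⟩ := hdec
  obtain ⟨p, hp⟩ := hstar
  -- the lone term
  obtain ⟨t₀, ht₀⟩ := Finset.card_eq_one.mp hcard
  have ht₀T : t₀ ∈ T ∧ S t₀ = A₀ := by
    have : t₀ ∈ T.filter (fun t => S t = A₀) := by rw [ht₀]; exact Finset.mem_singleton_self t₀
    exact Finset.mem_filter.mp this
  -- `A₀ = {p, a}`
  have hpairI : ∀ A ∈ T.image S, A.card = 2 := fun A hA => by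
    obtain ⟨t, ht, rfl⟩ := Finset.mem_image.mp hA; exact hpair t ht
  have hleaf : ∀ A ∈ T.image S, ∃ x : Fin 5, p ≠ x ∧ A = {p, x} := by
    intro A hA
    obtain ⟨x, y, hxy, hxy'⟩ := Finset.card_eq_two.mp (hpairI A hA)
    have hcm := hp A hA
    rw [hxy'] at hcm
    simp only [Finset.mem_insert, Finset.mem_singleton] at hcm
    rcases hcm with rfl | rfl
    · exact ⟨y, hxy, hxy'⟩
    · exact ⟨x, fun h => hxy (h ▸ rfl), by rw [hxy', Finset.pair_comm]⟩
  obtain ⟨a, hpa, hA₀e⟩ := hleaf A₀ hA₀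
  -- the other three leaves
  have h3 : ((T.image S).erase A₀).card = 3 := by rw [Finset.card_erase_of_mem hA₀, h4]
  obtain ⟨B₁, B₂, B₃, h12, h13, h23, hE⟩ := Finset.card_eq_three.mp h3
  have hB : ∀ B, B ∈ (T.image S).erase A₀ → ∃ x : Fin 5, p ≠ x ∧ x ≠ a ∧ B = {p, x} := by
    intro B hBm
    have hBI : B ∈ T.image S := Finset.mem_of_mem_erase hBm
    have hBne : B ≠ A₀ := Finset.ne_of_mem_erase hBm
    obtain ⟨x, hpx, hBe⟩ := hleaf B hBI
    refine ⟨x, hpx, fun h => hBne ?_, hBe⟩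
    rw [hBe, hA₀e, h]
  have m1 : B₁ ∈ (T.image S).erase A₀ := by rw [hE]; simp
  have m2 : B₂ ∈ (T.image S).erase A₀ := by rw [hE]; simp
  have m3 : B₃ ∈ (T.image S).erase A₀ := by rw [hE]; simp
  obtain ⟨b, hpb, hba, hB₁e⟩ := hB B₁ m1
  obtain ⟨c, hpc, hca, hB₂e⟩ := hB B₂ m2
  obtain ⟨d, hpd, hda, hB₃e⟩ := hB B₃ m3
  have hbc : b ≠ c := fun h => h12 (by rw [hB₁e, hB₂e, h])
  have hbd : b ≠ d := fun h => h13 (by rw [hB₁e, hB₃e, h])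
  have hcd : c ≠ d := fun h => h23 (by rw [hB₂e, hB₃e, h])
  have hab : a ≠ b := Ne.symm hba
  have hac : a ≠ c := Ne.symm hca
  have had : a ≠ d := Ne.symm hda
  -- the five slots exhaust `Fin 5`
  have hcover : ∀ i : Fin 5, i = p ∨ i = a ∨ i = b ∨ i = c ∨ i = d := by
    have hc5 : ({p, a, b, c, d} : Finset (Fin 5)).card = 5 := by
      rw [Finset.card_insert_of_notMem, Finset.card_insert_of_notMem, Finset.card_insert_of_notMem,
        Finset.card_pair hcd]
      · simp [hbc, hbd]
      · simp [hab, hac, had]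
      · simp [hpa, hpb, hpc, hpd]
    have huniv := Finset.eq_univ_of_card _ (by rw [hc5]; simp)
    intro i
    have hi : i ∈ ({p, a, b, c, d} : Finset (Fin 5)) := by rw [huniv]; exact Finset.mem_univ i
    simpa using hi
  -- shadows
  set Z : Finset (Fin 5) → (Fin 5 → Fin 5) → ℂ := fun A v => ∑ t ∈ T.filter (fun t => S t = A), u t v * w t v with hZ
  have hside : ∀ A ∈ T.image S, SlotInvariantOn A (Z A) ∧ SlotInvariantOn Aᶜ (Z A) := fun A _ =>
    ⟨fun τ hτ v => LaplaceFiveTriangleSeparation.shadow_inv_left T S u w hw hsym A τ hτ v,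
      fun τ hτ v => LaplaceFiveTriangleSeparation.shadow_inv_right T S u w hu hsym A τ hτ v⟩
  have hfib : ∀ v : Fin 5 → Fin 5, ∑ A ∈ T.image S, Z A v = if Function.Injective v then 1 else 0 := by
    intro v
    simp only [hZ]
    rw [Finset.sum_fiberwise_of_maps_to (g := S) (fun t (ht : t ∈ T) => Finset.mem_image_of_mem S ht)]
    exact hid v
  -- the sum of the four shadows is `[v injective]`, hence fully symmetric
  have himage : T.image S = insert A₀ (((T.image S).erase A₀)) := (Finset.insert_erase hA₀).symm
  have hsum4 : SlotInvariantOn Finset.univ (Z A₀ + Z B₁ + Z B₂ + Z B₃) := by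
    have e : Z A₀ + Z B₁ + Z B₂ + Z B₃ = fun v => ∑ A ∈ T.image S, Z A v := by
      funext v
      rw [himage, Finset.sum_insert (Finset.notMem_erase A₀ _), hE, Finset.sum_insert (by simp [h12, h13]),
        Finset.sum_insert (by simp [h23]), Finset.sum_singleton]
      simp only [Pi.add_apply]
      ring
    rw [e]
    intro τ _ v
    show (∑ A ∈ T.image S, Z A (v ∘ ⇑τ)) = ∑ A ∈ T.image S, Z A v
    rw [hfib, hfib, if_congr (Equiv.injective_comp τ v) rfl rfl]
  have hZ₀ : SlotInvariantOn A₀ (Z A₀) ∧ SlotInvariantOn A₀ᶜ (Z A₀) := hside A₀ hA₀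
  have coh := star_coherence p a b c d hpa hpb hpc hpd hab hac had hbc hbd hcd (Z A₀) (Z B₁) (Z B₂) (Z B₃)
    (by rw [← hA₀e]; exact hZ₀) (by rw [← hB₁e]; exact hside B₁ (Finset.mem_of_mem_erase m1))
    (by rw [← hB₂e]; exact hside B₂ (Finset.mem_of_mem_erase m2))
    (by rw [← hB₃e]; exact hside B₃ (Finset.mem_of_mem_erase m3)) hsum4
  have hsymm4 := coh.2.2.2
  -- the lone shadow is a single product
  have hZ₀eq : ∀ v, Z A₀ v = u t₀ v * w t₀ v := fun v => by
    show (∑ t ∈ T.filter (fun t => S t = A₀), u t v * w t v) = u t₀ v * w t₀ v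
    rw [ht₀, Finset.sum_singleton]
  -- hypotheses of the word-currency lemma for `u t₀`, `w t₀`
  have hS₀ : S t₀ = {p, a} := ht₀T.2.trans hA₀e
  have hu' : ∀ v v' : Fin 5 → Fin 5, v p = v' p → v a = v' a → u t₀ v = u t₀ v' := fun v v' h1 h2 =>
    hu t₀ v v' fun i hi => by
      rw [hS₀] at hi
      simp only [Finset.mem_insert, Finset.mem_singleton] at hi
      rcases hi with rfl | rfl
      · exact h1
      · exact h2
  have hw' : ∀ v v' : Fin 5 → Fin 5, v b = v' b → v c = v' c → v d = v' d → w t₀ v = w t₀ v' :=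
    fun v v' h1 h2 h3 => hw t₀ v v' fun i hi => by
      rw [hS₀] at hi
      simp only [Finset.mem_insert, Finset.mem_singleton, not_or] at hi
      rcases hcover i with h | h | h | h | h
      · exact absurd h hi.1
      · exact absurd h hi.2
      · rw [h]; exact h1
      · rw [h]; exact h2
      · rw [h]; exact h3
  have hsym₀ := hsym t₀ ht₀T.1
  have hus : ∀ v : Fin 5 → Fin 5, u t₀ (v ∘ ⇑(Equiv.swap p a)) = u t₀ v := fun v =>
    invUnder_swap_of_mem (A := S t₀) hsym₀.1 (by rw [hS₀]; simp) (by rw [hS₀]; simp) v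
  have hwbc : ∀ v : Fin 5 → Fin 5, w t₀ (v ∘ ⇑(Equiv.swap b c)) = w t₀ v := fun v =>
    invUnder_swap_of_not_mem (A := S t₀) hsym₀.2 (by rw [hS₀]; simp [Ne.symm hpb, Ne.symm hab])
      (by rw [hS₀]; simp [Ne.symm hpc, Ne.symm hac]) v
  have hwcd : ∀ v : Fin 5 → Fin 5, w t₀ (v ∘ ⇑(Equiv.swap c d)) = w t₀ v := fun v =>
    invUnder_swap_of_not_mem (A := S t₀) hsym₀.2 (by rw [hS₀]; simp [Ne.symm hpc, Ne.symm hac])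
      (by rw [hS₀]; simp [Ne.symm hpd, Ne.symm had]) v
  have hF : ∀ v : Fin 5 → Fin 5,
      u t₀ ((v ∘ ⇑(Equiv.swap p a))) * w t₀ ((v ∘ ⇑(Equiv.swap p a)))
        + u t₀ ((v ∘ ⇑(Equiv.swap p a)) ∘ ⇑(Equiv.swap a b)) * w t₀ ((v ∘ ⇑(Equiv.swap p a)) ∘ ⇑(Equiv.swap a b))
        + u t₀ ((v ∘ ⇑(Equiv.swap p a)) ∘ ⇑(Equiv.swap a c)) * w t₀ ((v ∘ ⇑(Equiv.swap p a)) ∘ ⇑(Equiv.swap a c))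
        + u t₀ ((v ∘ ⇑(Equiv.swap p a)) ∘ ⇑(Equiv.swap a d)) * w t₀ ((v ∘ ⇑(Equiv.swap p a)) ∘ ⇑(Equiv.swap a d))
      = u t₀ v * w t₀ v + u t₀ (v ∘ ⇑(Equiv.swap a b)) * w t₀ (v ∘ ⇑(Equiv.swap a b))
        + u t₀ (v ∘ ⇑(Equiv.swap a c)) * w t₀ (v ∘ ⇑(Equiv.swap a c))
        + u t₀ (v ∘ ⇑(Equiv.swap a d)) * w t₀ (v ∘ ⇑(Equiv.swap a d)) := by
    intro v
    have h := hsymm4 (Equiv.swap p a) (fun i hi => absurd (Finset.mem_univ i) hi) v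
    simp only [Pi.add_apply, hZ₀eq] at h
    exact h
  have hcross := lone_term_crossSwap p a b c d hpa hpb hpc hpd hab hac had hbc hbd hcd (u t₀) (w t₀)
    hu' hw' hus hwbc hwcd hF
  -- cross-swap invariance ⟹ full symmetry of the lone shadow
  have hinv : InvUnder (Equiv.swap a b) (Z A₀) := fun v => by rw [hZ₀eq, hZ₀eq]; exact hcross v
  have hfull := full_of_crossSwap (S := A₀) hZ₀.1 hZ₀.2 (c := a) (d := b) (by rw [hA₀e]; simp)
    (by rw [hA₀e]; simp [Ne.symm hpb, Ne.symm hab]) hinv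
  exact hfull

end LaplaceFiveStar

end Summit.ValiantsHypothesis.ValiantsHypothesis.Theorems.RigidityForcesSymmetryRankRigidMinimalRepr
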